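/-
Copyright: width seat `ym-line-sll-p4` (prover-ym-line-sll-p4-g0-0), route `SoftLoopLongLag`, cruxes K′ `SoftLoopLagFloorToTorus`
(stmt-QuantumFields-22504) / T′ `ColdBoxSoftLoopLagFloor` (stmt-QuantumFields-24180), line `birth` — the N2-loops ASSEMBLY (one-scale kernel
mean expansion of ONE `R×R` loop with datum), modulo the numeric exponent bookkeeping `hnum` (statement file to follow in the crux dir).
-/
import Summits.QuantumFields.YangMills.Theorems.SoftLoopLongLagLoopMeanExpansionPrelims
import Summits.QuantumFields.YangMills.Theorems.ColdBoxAllGroupsBulkAllGroupsStubKernelMeanExpansionG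

/-!
# Route `SoftLoopLongLag`, line `birth` (both cruxes), engine statement N2-loops: the ASSEMBLY of the one-scale kernel MEAN expansion of an
# `R×R` Wilson loop with datum, every compact group presented in `U(N)`, modulo the numeric exponent bookkeeping

Loop twin of the sibling's landed `kernelMeanExpansionG_of_bounds` (`Theorems/ColdBoxAllGroupsBulkAllGroupsStubKernelMeanExpansionG.lean`,
crux `BulkAllGroups`).  Parameters: box `H = ⌈β^θ⌉`, datum scale `δ` (crude-good data `CrudeGoodG ρ β δ H`), cold threshold `ε = 6θ`
(`δ < 3θ`, `9θ + δ < 1/2`), loop side `R = ⌈β^{ε_R}⌉`; the bookkeeping quantities `r, L, m = 2L, R_g, R', mE, P, pY, ℓ, τ, w` are the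
sibling's (PLAN v6 dictionary), the loop-specific ones are the surrogate accuracy `τ_ℓ = 9β(4Rm)³`, the on-window bound
`M_ℓ = β(8D(R²m)² + 9(4Rm)³)` and the fourth-moment constant `B = 2D²((R²R')⁴ + 3R⁸)`.

**`loopMeanExpansion_of_bounds`** — IF the numeric facts hold eventually in `β` for all positive constants `Ca CE r₂ C₂ η₀` (hypothesis `hnum`:
the sibling's MEAN list with `τ ↦ τ_ℓ`, `M ↦ M_ℓ`, the fourth-moment constant `↦ B`, plus `4R·m ≤ 1/4`), THEN the N2-loops interface of the
landed E2 reduction `innerDatumMeanSmoothG_of_loopMeanExpansion` holds with `Good := CrudeGoodG ρ β δ ⌈β^θ⌉₊`, `b := θ`, `ε := ε_R`: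
for `β ≥ β₀` and every crude-good `ζ` there are Dirichlet data `ϑI` and competitors `sI` of energy `≤ CE(2H+3)⁴β^{2δ−1}` with, at every base point
`x` with `‖x − boxCentre H‖ + R ≤ H/8`,
  `|β·E_ζ[N − Re tr ρ(hol_{ℓ_x})] − (D/2)·Σ_{p,q∈S(x)} boxDirProjKernel H p q − β·Σ_c (Σ_{p∈S(x)} F̄I_c(p))²| ≤ β^{−θ}`.
Chain: datum package (`exists_datum_packageG_datVec`), chart density (Helgason `J`), von Neumann radius, YM bad mass at the charted datum
(`boxKernelG_real_coldGoodSetG_compl_le_trunc`, `ε = 6θ`), Gaussian bad mass (`gaussD_real_compl_goodTDE_inter_ball_le`), tilt bound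
(`abs_tiltWDE_le_of_window`), the loop Gaussian bookkeeping of seat p5 (`memLp_two_quadSurf_piD`, `integral_quadSurf_sq_piD_le`, `integral_quadSurf_piD_eq`
on `loopSurf x R`), this seat's loop mean core with datum `abs_kernelMeanG_loopCost_sub_gaussMean_le_datum`, the kernel bridge
`integral_boxKernelG_eq_of_gauge_trunc` with the loop cost's locality `loopCost_eq_of_agree_enlarged`, and the units U1 in surface form.

No sorry; no new definition; standard axioms.  HONEST LABEL: rung R2xi-G RECORD label (leaf `WeakCouplingRates.XiPow`, an UPPER bound on the lattice
mass gap); NOT the Clay mass gap; no summit statement is touched.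
-/

set_option autoImplicit false

noncomputable section

open MeasureTheory ProbabilityTheory Finset Real Filter Topology Metric
open scoped ENNReal Matrix.Norms.Frobenius
open Literature.Probability.LatticeModels (Site glueWith)
open Literature.MathematicalPhysics.QuantumLattice
open Literature.MathematicalPhysics.QuantumFieldTheory
open Literature.MathematicalPhysics.QuantumFieldTheory.LatticeMaxwell
open Literature.MathematicalPhysics.QuantumFieldTheory.AxialGauge
open Summit.QuantumFields.YangMills.Theorems.WeakCouplingRates
open Summit.QuantumFields.YangMills.Theorems.FreeEnergyLogCoefficient
open Summit.QuantumFields.YangMills.Theorems.ColdBoxAllGroups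

namespace Summit.QuantumFields.YangMills.Theorems.SoftLoopLongLag

/-- **(U1, indexed surface form)** `½Σ_c (Σ_{i∈S} F'_c(pl i))² = β·Σ_c (Σ_{i∈S} F̄I_c(pl i))²` for any finite index set and plaquette map. -/
theorem half_sum_sq_sum_dirBackground_sdatE_eq {H D : ℕ} {β : ℝ} (hβ : 0 ≤ β)
    (ϑ : Fin D → Literature.MathematicalPhysics.QuantumLattice.ZdEdge 4 → ℝ) {ι : Type*} (S : Finset ι) (pl : ι → Plaq 4) :
    1 / 2 * (∑ c, (∑ i ∈ S, sCirc (glue (pin := fun e => e ∉ dirFreeEdges H) dirCorner (2 * H + 3) (sdatE β ϑ c)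
        (mean (fun e => e ∉ dirFreeEdges H) dirCorner (2 * H + 3) (sdatE β ϑ c))) (pl i)) ^ 2) =
      β * (∑ c, (∑ i ∈ S, sCirc (glue (pin := fun e => e ∉ dirFreeEdges H) dirCorner (2 * H + 3) ((Real.sqrt 2)⁻¹ • ϑ c)
        (mean (fun e => e ∉ dirFreeEdges H) dirCorner (2 * H + 3) ((Real.sqrt 2)⁻¹ • ϑ c))) (pl i)) ^ 2) := by
  have hβ2 : Real.sqrt β ^ 2 = β := Real.sq_sqrt hβ
  simp_rw [dirBackground_sdatE_eq, sCirc_glue_smul_mean ((Real.sqrt 2)⁻¹), ← Finset.mul_sum, mul_pow, hβ2, sqrt_two_inv_sq]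
  rw [← Finset.mul_sum, ← Finset.mul_sum]; ring

variable {N : ℕ} [NeZero N] {G : Type} [Group G] [TopologicalSpace G] [IsTopologicalGroup G] [CompactSpace G]
  [MeasurableSpace G] [BorelSpace G]
variable (ρ : G →* Matrix (Fin N) (Fin N) ℂ)

set_option maxHeartbeats 1600000 in
/-- **N2-loops modulo the numeric bookkeeping** — the one-scale expansion of the kernel mean of an `R×R` Wilson loop with datum, every compact group
presented in `U(N)` (faithful continuous unitary `ρ`, `N ≥ 1`), in the interface shape of the landed E2 reduction; see the module docstring for the
dictionary of `hnum`. [folklore] -/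
theorem loopMeanExpansion_of_bounds (hρc : Continuous ρ) (hinj : Function.Injective ρ)
    (hρu : ∀ g, ρ g ∈ Matrix.unitaryGroup (Fin N) ℂ) {θ δ εR : ℝ} (hθ : 0 < θ) (hδ : 0 ≤ δ) (hδθ : δ < 3 * θ)
    (hwin9 : 9 * θ + δ < 1 / 2)
    (hnum : ∀ Ca CE r₂ C₂ η₀ : ℝ, 0 < Ca → 0 < CE → 0 < r₂ → 0 < C₂ → 0 < η₀ → ∀ᶠ β : ℝ in atTop,
      1 ≤ β ∧
      -- the link window is inside von Neumann's radius: `L ≤ η₀`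
      (12 * (⌈β ^ θ⌉₊ : ℝ) ^ 2 + 2 * ⌈β ^ θ⌉₊ + 1) *
          (Real.sqrt 2 * Real.sqrt (β ^ (2 * (6 * θ) - 1)) + 8 * (Ca * β ^ (3 * θ + δ - 1 / 2))) ≤ η₀ ∧
      -- `m = 2L ≤ 1/4`, `m ≤ r₂`
      2 * ((12 * (⌈β ^ θ⌉₊ : ℝ) ^ 2 + 2 * ⌈β ^ θ⌉₊ + 1) *
          (Real.sqrt 2 * Real.sqrt (β ^ (2 * (6 * θ) - 1)) + 8 * (Ca * β ^ (3 * θ + δ - 1 / 2)))) ≤ 1 / 4 ∧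
      2 * ((12 * (⌈β ^ θ⌉₊ : ℝ) ^ 2 + 2 * ⌈β ^ θ⌉₊ + 1) *
          (Real.sqrt 2 * Real.sqrt (β ^ (2 * (6 * θ) - 1)) + 8 * (Ca * β ^ (3 * θ + δ - 1 / 2)))) ≤ r₂ ∧
      -- the sandwich radius: `mE ≤ m`
      Real.sqrt (dimE ρ) * ((12 * (⌈β ^ θ⌉₊ : ℝ) ^ 2 + 2 * ⌈β ^ θ⌉₊ + 1) *
          ((β ^ (6 * θ) / (4 * (Real.sqrt (dimE ρ) + 1)) +
              (Real.sqrt (β * (CE * (2 * (⌈β ^ θ⌉₊ : ℝ) + 3) ^ 4 * β ^ (2 * δ - 1))) +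
                4 * (Real.sqrt β * (Ca * β ^ (3 * θ + δ - 1 / 2))))) +
            4 * (Real.sqrt β * (Ca * β ^ (3 * θ + δ - 1 / 2))))) / Real.sqrt β ≤
        2 * ((12 * (⌈β ^ θ⌉₊ : ℝ) ^ 2 + 2 * ⌈β ^ θ⌉₊ + 1) *
          (Real.sqrt 2 * Real.sqrt (β ^ (2 * (6 * θ) - 1)) + 8 * (Ca * β ^ (3 * θ + δ - 1 / 2)))) ∧
      -- `r ≤ m`
      Ca * β ^ (3 * θ + δ - 1 / 2) ≤
        2 * ((12 * (⌈β ^ θ⌉₊ : ℝ) ^ 2 + 2 * ⌈β ^ θ⌉₊ + 1) *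
          (Real.sqrt 2 * Real.sqrt (β ^ (2 * (6 * θ) - 1)) + 8 * (Ca * β ^ (3 * θ + δ - 1 / 2)))) ∧
      -- the cost window of the sandwich
      (dimE ρ : ℝ) / 2 * (β ^ (6 * θ) / (4 * (Real.sqrt (dimE ρ) + 1)) +
            (Real.sqrt (β * (CE * (2 * (⌈β ^ θ⌉₊ : ℝ) + 3) ^ 4 * β ^ (2 * δ - 1))) +
              4 * (Real.sqrt β * (Ca * β ^ (3 * θ + δ - 1 / 2))))) ^ 2 / β +
          190 * (2 * ((12 * (⌈β ^ θ⌉₊ : ℝ) ^ 2 + 2 * ⌈β ^ θ⌉₊ + 1) *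
            (Real.sqrt 2 * Real.sqrt (β ^ (2 * (6 * θ) - 1)) + 8 * (Ca * β ^ (3 * θ + δ - 1 / 2))))) ^ 3 <
        β ^ (2 * (6 * θ) - 1) ∧
      -- the Gaussian bad mass `P ≤ 1/2`
      240 * (dimE ρ : ℝ) * (2 * (⌈β ^ θ⌉₊ : ℝ) + 1) ^ 4 *
          Real.exp (-(β ^ (6 * θ) / (4 * (Real.sqrt (dimE ρ) + 1))) ^ 2 / 2) ≤ 1 / 2 ∧
      -- the loop perimeter fits the chart window: `4R·m ≤ 1/4`
      2 * ((⌈β ^ εR⌉₊ : ℝ) + ⌈β ^ εR⌉₊) * (2 * ((12 * (⌈β ^ θ⌉₊ : ℝ) ^ 2 + 2 * ⌈β ^ θ⌉₊ + 1) *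
          (Real.sqrt 2 * Real.sqrt (β ^ (2 * (6 * θ) - 1)) + 8 * (Ca * β ^ (3 * θ + δ - 1 / 2))))) ≤ 1 / 4 ∧
      -- LOOP-MEAN-RHS ≤ β^{−θ}
      2 * (2 * N * β) * Real.exp (-(β ^ (6 * θ))) +
          ((β * (8 * (dimE ρ : ℝ) * ((⌈β ^ εR⌉₊ : ℝ) * ⌈β ^ εR⌉₊ *
                (2 * ((12 * (⌈β ^ θ⌉₊ : ℝ) ^ 2 + 2 * ⌈β ^ θ⌉₊ + 1) *
                  (Real.sqrt 2 * Real.sqrt (β ^ (2 * (6 * θ) - 1)) + 8 * (Ca * β ^ (3 * θ + δ - 1 / 2)))))) ^ 2 +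
              9 * (2 * ((⌈β ^ εR⌉₊ : ℝ) + ⌈β ^ εR⌉₊) * (2 * ((12 * (⌈β ^ θ⌉₊ : ℝ) ^ 2 + 2 * ⌈β ^ θ⌉₊ + 1) *
                  (Real.sqrt 2 * Real.sqrt (β ^ (2 * (6 * θ) - 1)) + 8 * (Ca * β ^ (3 * θ + δ - 1 / 2)))))) ^ 3)) *
              (Real.exp (2 * (120 * (2 * (⌈β ^ θ⌉₊ : ℝ) + 1) ^ 4 *
                  (190 * β * (2 * ((12 * (⌈β ^ θ⌉₊ : ℝ) ^ 2 + 2 * ⌈β ^ θ⌉₊ + 1) *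
                    (Real.sqrt 2 * Real.sqrt (β ^ (2 * (6 * θ) - 1)) + 8 * (Ca * β ^ (3 * θ + δ - 1 / 2))))) ^ 3) +
                4 * (2 * (⌈β ^ θ⌉₊ : ℝ) + 1) ^ 4 *
                  (2 * C₂ * (2 * ((12 * (⌈β ^ θ⌉₊ : ℝ) ^ 2 + 2 * ⌈β ^ θ⌉₊ + 1) *
                    (Real.sqrt 2 * Real.sqrt (β ^ (2 * (6 * θ) - 1)) + 8 * (Ca * β ^ (3 * θ + δ - 1 / 2))))) ^ 2))) - 1) +
            9 * β * (2 * ((⌈β ^ εR⌉₊ : ℝ) + ⌈β ^ εR⌉₊) * (2 * ((12 * (⌈β ^ θ⌉₊ : ℝ) ^ 2 + 2 * ⌈β ^ θ⌉₊ + 1) *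
                (Real.sqrt 2 * Real.sqrt (β ^ (2 * (6 * θ) - 1)) + 8 * (Ca * β ^ (3 * θ + δ - 1 / 2)))))) ^ 3 +
            2 * (1 + 2 * (dimE ρ : ℝ) * ((dimE ρ : ℝ) * (((⌈β ^ εR⌉₊ : ℝ) ^ 2 * (Real.sqrt (β * (CE * (2 * (⌈β ^ θ⌉₊ : ℝ) + 3) ^ 4 * β ^ (2 * δ - 1))) + 4 * (Real.sqrt β * (Ca * β ^ (3 * θ + δ - 1 / 2))))) ^ 4 + 3 * (⌈β ^ εR⌉₊ : ℝ) ^ 8))) *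
              Real.sqrt (240 * (dimE ρ : ℝ) * (2 * (⌈β ^ θ⌉₊ : ℝ) + 1) ^ 4 *
                Real.exp (-(β ^ (6 * θ) / (4 * (Real.sqrt (dimE ρ) + 1))) ^ 2 / 2))) ≤
        β ^ (-θ)) :
    ∃ CE : ℝ, ∃ β₀ : ℝ, ∀ β : ℝ, β₀ ≤ β → ∀ ζ : LGConfig 4 G, CrudeGoodG ρ β δ ⌈β ^ θ⌉₊ ζ →
      ∃ ϑ : Fin (dimE ρ) → (Literature.MathematicalPhysics.QuantumLattice.ZdEdge 4 → ℝ),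
      ∃ s : Fin (dimE ρ) → (DirFree ⌈β ^ θ⌉₊ → ℝ),
        (∑ c, formM (fun e => e ∉ dirFreeEdges ⌈β ^ θ⌉₊) dirCorner (2 * ⌈β ^ θ⌉₊ + 3) (ϑ c) (s c) ≤
            CE * (2 * (⌈β ^ θ⌉₊ : ℝ) + 3) ^ 4 * β ^ (2 * δ - 1)) ∧
        ∀ x : Site 4, ‖x - boxCentre ⌈β ^ θ⌉₊‖ + ⌈β ^ εR⌉₊ ≤ (⌈β ^ θ⌉₊ : ℝ) / 8 →
          |β * (∫ U, ((N : ℝ) - (ρ (walkHolonomy U (rectWalk x 1 2 ⌈β ^ εR⌉₊ ⌈β ^ εR⌉₊))).trace.re)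
                ∂(boxKernelG ρ β ⌈β ^ θ⌉₊ ζ)) -
              (dimE ρ : ℝ) / 2 * (∑ p ∈ rectSurface x ⌈β ^ εR⌉₊ ⌈β ^ εR⌉₊, ∑ q ∈ rectSurface x ⌈β ^ εR⌉₊ ⌈β ^ εR⌉₊,
                boxDirProjKernel ⌈β ^ θ⌉₊ ((p.1, p.2.1.1, p.2.1.2) : Plaq 4) ((q.1, q.2.1.1, q.2.1.2) : Plaq 4)) -
              β * ∑ c, (∑ p ∈ rectSurface x ⌈β ^ εR⌉₊ ⌈β ^ εR⌉₊,
                sCirc (LatticeMaxwell.glue (pin := fun e => e ∉ dirFreeEdges ⌈β ^ θ⌉₊) dirCorner (2 * ⌈β ^ θ⌉₊ + 3)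
                  (ϑ c) (mean (fun e => e ∉ dirFreeEdges ⌈β ^ θ⌉₊) dirCorner (2 * ⌈β ^ θ⌉₊ + 3) (ϑ c)))
                  ((p.1, p.2.1.1, p.2.1.2) : Plaq 4)) ^ 2| ≤ β ^ (-θ) := by
  haveI : SecondCountableTopology (Matrix (Fin N) (Fin N) ℂ) := inferInstanceAs (SecondCountableTopology (Fin N → Fin N → ℂ))
  haveI : SecondCountableTopology G := (hρc.isClosedEmbedding hinj).isEmbedding.secondCountableTopology
  -- exponents
  have hε : 3 * θ + δ < 6 * θ := by linarith
  -- structural inputs: the datum package, the chart density, von Neumann's radius, the YM bad mass at `W`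
  obtain ⟨Ca, CE, hCa, hCE, β₁, hpack⟩ := exists_datum_packageG_datVec ρ hρc hinj hρu (θ := θ) (δ := δ) hθ hδ hwin9
  obtain ⟨r₂, C₂, cH, hr₂, -, hC₂, hcH, J, hJc, hJb, hJhalf, hdens⟩ :=
    exists_chartMeasureE_restrict_closedBall_eq_withDensity ρ hρc hinj hρu
  obtain ⟨η₀, hη₀, hwinη⟩ := linkWindow_subset_image_expChart ρ hρc hinj hρu
  obtain ⟨β₂, hrare⟩ := boxKernelG_real_coldGoodSetG_compl_le_trunc ρ hρu hρc (θ := θ) (δ := δ) (ε := 6 * θ) hθ hδ hε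
  obtain ⟨β₃, hnumE⟩ := Filter.eventually_atTop.1 (hnum Ca CE r₂ C₂ η₀ hCa hCE hr₂ hC₂ hη₀)
  -- the threshold
  refine ⟨CE, max β₁ (max β₂ β₃), fun β hβ ζ hζ => ?_⟩
  have hb₁ : β₁ ≤ β := (le_max_left _ _).trans hβ
  have hb₂ : β₂ ≤ β := ((le_max_left _ _).trans (le_max_right _ _)).trans hβ
  have hb₃ : β₃ ≤ β := ((le_max_right _ _).trans (le_max_right _ _)).trans hβ
  obtain ⟨hβ1, hLη, hm4, hmr₂, hmEm, hrm, hwin, hP2, hRT, hfinal⟩ := hnumE β hb₃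
  have hβ0 : 0 < β := by linarith
  obtain ⟨hH1r, -⟩ := one_le_ceil_rpow_and_le hβ1 hθ.le
  have hH : 1 ≤ ⌈β ^ θ⌉₊ := by exact_mod_cast hH1r
  -- the datum package and the YM bad mass at this `β`
  obtain ⟨g, ϑ, s, hW, hϑr, -, -, hforest, hs, hE⟩ := hpack β hb₁ ζ hζ
  have hpY := hrare β hb₂ ζ hζ g
  have hpY1 : Real.exp (-(β ^ (6 * θ))) < 1 := by
    rw [Real.exp_lt_one_iff, neg_lt_zero]; exact Real.rpow_pos_of_pos hβ0 _
  -- signs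
  have hr0 : (0 : ℝ) ≤ (Ca * β ^ (3 * θ + δ - 1 / 2)) := by positivity
  have hR0 : (0 : ℝ) ≤ β ^ (6 * θ) / (4 * (Real.sqrt (dimE ρ) + 1)) := by positivity
  have hR'0 : (0 : ℝ) ≤ (Real.sqrt (β * (CE * (2 * (⌈β ^ θ⌉₊ : ℝ) + 3) ^ 4 * β ^ (2 * δ - 1))) + 4 * (Real.sqrt β * (Ca * β ^ (3 * θ + δ - 1 / 2)))) := by positivity
  have hm0 : 0 ≤ (2 * ((12 * (⌈β ^ θ⌉₊ : ℝ) ^ 2 + 2 * ⌈β ^ θ⌉₊ + 1) * (Real.sqrt 2 * Real.sqrt (β ^ (2 * (6 * θ) - 1)) + 8 * (Ca * β ^ (3 * θ + δ - 1 / 2))))) := hr0.trans hrm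
  have hmpos : (0 : ℝ) < (2 * ((12 * (⌈β ^ θ⌉₊ : ℝ) ^ 2 + 2 * ⌈β ^ θ⌉₊ + 1) * (Real.sqrt 2 * Real.sqrt (β ^ (2 * (6 * θ) - 1)) + 8 * (Ca * β ^ (3 * θ + δ - 1 / 2))))) := by
    have : 0 < Real.sqrt (β ^ (2 * (6 * θ) - 1)) := Real.sqrt_pos.2 (Real.rpow_pos_of_pos hβ0 _)
    positivity
  have hτ0 : (0 : ℝ) ≤ 190 * β * (2 * ((12 * (⌈β ^ θ⌉₊ : ℝ) ^ 2 + 2 * ⌈β ^ θ⌉₊ + 1) * (Real.sqrt 2 * Real.sqrt (β ^ (2 * (6 * θ) - 1)) + 8 * (Ca * β ^ (3 * θ + δ - 1 / 2))))) ^ 3 := by positivity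
  have hℓ0 : (0 : ℝ) ≤ 2 * C₂ * (2 * ((12 * (⌈β ^ θ⌉₊ : ℝ) ^ 2 + 2 * ⌈β ^ θ⌉₊ + 1) * (Real.sqrt 2 * Real.sqrt (β ^ (2 * (6 * θ) - 1)) + 8 * (Ca * β ^ (3 * θ + δ - 1 / 2))))) ^ 2 := by positivity
  -- the datum in the shapes of the bricks
  have hW' : ∀ e, e ∉ AxialGauge.boxEdges 4 (2 * ⌈β ^ θ⌉₊ + 1) → _ := fun e _ => hW e
  have hϑ' : ∀ e, e ∉ AxialGauge.boxEdges 4 (2 * ⌈β ^ θ⌉₊ + 1) → ‖datVec ϑ e‖ ≤ (Ca * β ^ (3 * θ + δ - 1 / 2)) := fun e _ => hϑr e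
  have hϑm : ∀ e, e ∉ AxialGauge.boxEdges 4 (2 * ⌈β ^ θ⌉₊ + 1) → ‖datVec ϑ e‖ ≤ (2 * ((12 * (⌈β ^ θ⌉₊ : ℝ) ^ 2 + 2 * ⌈β ^ θ⌉₊ + 1) * (Real.sqrt 2 * Real.sqrt (β ^ (2 * (6 * θ) - 1)) + 8 * (Ca * β ^ (3 * θ + δ - 1 / 2))))) := fun e _ => (hϑr e).trans hrm
  have hϑsq : ∀ e, e ∉ AxialGauge.boxEdges 4 (2 * ⌈β ^ θ⌉₊ + 1) → ∑ c, ϑ c e ^ 2 ≤ (Ca * β ^ (3 * θ + δ - 1 / 2)) ^ 2 := fun e _ => by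
    rw [← norm_datVec_sq]; exact pow_le_pow_left₀ (norm_nonneg _) (hϑr e) 2
  -- the interface datum `ϑI = (√2)⁻¹•ϑ` and its energy clause
  refine ⟨fun c => (Real.sqrt 2)⁻¹ • ϑ c, fun c => (Real.sqrt 2)⁻¹ • s c, sum_formM_interface_le ϑ s hE, fun x hx => ?_⟩
  beta_reduce
  -- the square: its surface touches the cold box, its links lie in the enlarged box
  have hS := rectSurface_subset_plaquettesTouching (R := ⌈β ^ εR⌉₊) hH hx
  have hRle : (⌈β ^ εR⌉₊ : ℝ) ≤ (⌈β ^ θ⌉₊ : ℝ) / 8 := by linarith [norm_nonneg (x - boxCentre ⌈β ^ θ⌉₊)]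
  have hx2 : ‖x - boxCentre ⌈β ^ θ⌉₊‖ + (⌈β ^ εR⌉₊ + ⌈β ^ εR⌉₊ : ℕ) ≤ (⌈β ^ θ⌉₊ : ℝ) / 2 := by push_cast; linarith [norm_nonneg (x - boxCentre ⌈β ^ θ⌉₊)]
  -- the chart density at radius `(2 * ((12 * (⌈β ^ θ⌉₊ : ℝ) ^ 2 + 2 * ⌈β ^ θ⌉₊ + 1) * (Real.sqrt 2 * Real.sqrt (β ^ (2 * (6 * θ) - 1)) + 8 * (Ca * β ^ (3 * θ + δ - 1 / 2)))))`
  have hgpos : ∀ a : EuclideanSpace ℝ (Fin (dimE ρ)), ‖a‖ ≤ (2 * ((12 * (⌈β ^ θ⌉₊ : ℝ) ^ 2 + 2 * ⌈β ^ θ⌉₊ + 1) * (Real.sqrt 2 * Real.sqrt (β ^ (2 * (6 * θ) - 1)) + 8 * (Ca * β ^ (3 * θ + δ - 1 / 2))))) → 0 < J a := fun a ha => by linarith [(hJhalf a (ha.trans hmr₂)).1]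
  have hg : ∀ a : EuclideanSpace ℝ (Fin (dimE ρ)), ‖a‖ ≤ (2 * ((12 * (⌈β ^ θ⌉₊ : ℝ) ^ 2 + 2 * ⌈β ^ θ⌉₊ + 1) * (Real.sqrt 2 * Real.sqrt (β ^ (2 * (6 * θ) - 1)) + 8 * (Ca * β ^ (3 * θ + δ - 1 / 2))))) → |Real.log (J a)| ≤ 2 * C₂ * (2 * ((12 * (⌈β ^ θ⌉₊ : ℝ) ^ 2 + 2 * ⌈β ^ θ⌉₊ + 1) * (Real.sqrt 2 * Real.sqrt (β ^ (2 * (6 * θ) - 1)) + 8 * (Ca * β ^ (3 * θ + δ - 1 / 2))))) ^ 2 := fun a ha => by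
    refine (abs_log_jacobian_le hJb hJhalf a (ha.trans hmr₂)).trans ?_
    have : ‖a‖ ^ 2 ≤ (2 * ((12 * (⌈β ^ θ⌉₊ : ℝ) ^ 2 + 2 * ⌈β ^ θ⌉₊ + 1) * (Real.sqrt 2 * Real.sqrt (β ^ (2 * (6 * θ) - 1)) + 8 * (Ca * β ^ (3 * θ + δ - 1 / 2))))) ^ 2 := pow_le_pow_left₀ (norm_nonneg _) ha 2
    nlinarith
  have hc0 : ENNReal.ofReal cH ≠ 0 := by rw [ENNReal.ofReal_ne_zero_iff]; exact hcH
  have hdensm := hdens _ hmpos hmr₂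
  -- the link window (`hball`) at radius `(2 * ((12 * (⌈β ^ θ⌉₊ : ℝ) ^ 2 + 2 * ⌈β ^ θ⌉₊ + 1) * (Real.sqrt 2 * Real.sqrt (β ^ (2 * (6 * θ) - 1)) + 8 * (Ca * β ^ (3 * θ + δ - 1 / 2))))) = 2L`
  have hball : ∀ u : G, ‖ρ u - 1‖ ≤ (12 * (⌈β ^ θ⌉₊ : ℝ) ^ 2 + 2 * ⌈β ^ θ⌉₊ + 1) * (Real.sqrt 2 * Real.sqrt (β ^ (2 * (6 * θ) - 1)) + 8 * (Ca * β ^ (3 * θ + δ - 1 / 2))) →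
      u ∈ expChart ρ '' closedBall (0 : EuclideanSpace ℝ (Fin (dimE ρ))) (2 * ((12 * (⌈β ^ θ⌉₊ : ℝ) ^ 2 + 2 * ⌈β ^ θ⌉₊ + 1) * (Real.sqrt 2 * Real.sqrt (β ^ (2 * (6 * θ) - 1)) + 8 * (Ca * β ^ (3 * θ + δ - 1 / 2))))) := fun u hu => hwinη _ hLη u hu
  -- the scaled background bound `(Real.sqrt (β * (CE * (2 * (⌈β ^ θ⌉₊ : ℝ) + 3) ^ 4 * β ^ (2 * δ - 1))) + 4 * (Real.sqrt β * (Ca * β ^ (3 * θ + δ - 1 / 2))))` on all plaquettes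
  have hF := fun (c : Fin (dimE ρ)) (p : ZdPlaquette 4) => abs_dirBackground_sdatE_le hβ0.le hr0 hϑsq hforest s hE c p
  -- the Gaussian bad mass and the tilt bound on the window
  have hPS := gaussD_real_compl_goodTDE_inter_ball_le ρ hρc (ε := 6 * θ) hβ0 hH hr0 hR0 hR'0 hϑ' hforest hF hmEm hrm hm4 hwin
  have hWb : ∀ t ∈ goodTDE ρ ⌈β ^ θ⌉₊ β (6 * θ) ϑ ∩ {t | ∀ e : ColdFreeIdx ⌈β ^ θ⌉₊,
      ‖unscaleTE ⌈β ^ θ⌉₊ (dimE ρ) β (t + meanTE ⌈β ^ θ⌉₊ (dimE ρ) β ϑ) e‖ ≤ (2 * ((12 * (⌈β ^ θ⌉₊ : ℝ) ^ 2 + 2 * ⌈β ^ θ⌉₊ + 1) * (Real.sqrt 2 * Real.sqrt (β ^ (2 * (6 * θ) - 1)) + 8 * (Ca * β ^ (3 * θ + δ - 1 / 2)))))}, _ :=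
    fun t ht => abs_tiltWDE_le_of_window ρ hρc hβ0 hm0 hm4 hg hforest hϑm t ht.2
  -- the loop Gaussian bookkeeping (seat p5's surface-flux layer) on `loopSurf x R`
  have hQ2 := memLp_two_quadSurf_piD (H := ⌈β ^ θ⌉₊) (D := dimE ρ)
    (fun c => ∑ p ∈ rectSurface x ⌈β ^ εR⌉₊ ⌈β ^ εR⌉₊, sCirc (glue (pin := fun e => e ∉ dirFreeEdges ⌈β ^ θ⌉₊) dirCorner (2 * ⌈β ^ θ⌉₊ + 3) (sdatE β ϑ c)
      (mean (fun e => e ∉ dirFreeEdges ⌈β ^ θ⌉₊) dirCorner (2 * ⌈β ^ θ⌉₊ + 3) (sdatE β ϑ c))) ((p.1, p.2.1.1, p.2.1.2) : Plaq 4)) (loopSurf x ⌈β ^ εR⌉₊)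
  have hQsq := integral_quadSurf_sq_piD_le (H := ⌈β ^ θ⌉₊) (D := dimE ρ)
    (fun c => ∑ p ∈ rectSurface x ⌈β ^ εR⌉₊ ⌈β ^ εR⌉₊, sCirc (glue (pin := fun e => e ∉ dirFreeEdges ⌈β ^ θ⌉₊) dirCorner (2 * ⌈β ^ θ⌉₊ + 3) (sdatE β ϑ c)
      (mean (fun e => e ∉ dirFreeEdges ⌈β ^ θ⌉₊) dirCorner (2 * ⌈β ^ θ⌉₊ + 3) (sdatE β ϑ c))) ((p.1, p.2.1.1, p.2.1.2) : Plaq 4)) (loopSurf x ⌈β ^ εR⌉₊)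
  have h4 := integral_quadSurf_piD_eq (H := ⌈β ^ θ⌉₊) (D := dimE ρ)
    (fun c => ∑ p ∈ rectSurface x ⌈β ^ εR⌉₊ ⌈β ^ εR⌉₊, sCirc (glue (pin := fun e => e ∉ dirFreeEdges ⌈β ^ θ⌉₊) dirCorner (2 * ⌈β ^ θ⌉₊ + 3) (sdatE β ϑ c)
      (mean (fun e => e ∉ dirFreeEdges ⌈β ^ θ⌉₊) dirCorner (2 * ⌈β ^ θ⌉₊ + 3) (sdatE β ϑ c))) ((p.1, p.2.1.1, p.2.1.2) : Plaq 4)) (loopSurf x ⌈β ^ εR⌉₊)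
  simp only [dirSurfCirc_loopSurf] at hQ2 hQsq h4
  rw [dirSurfInductance_loopSurf] at hQsq h4
  -- the deterministic loop mean core with datum, at `W`
  have hcore := abs_kernelMeanG_loopCost_sub_gaussMean_le_datum ρ hρc hinj hρu (ε := 6 * θ) hJc.measurable hβ1 hH hr0 hrm hm4 hW' hϑsq
    hforest hball hgpos hc0 ENNReal.ofReal_ne_top hdensm hpY hpY1 hPS hP2 hWb x ⌈β ^ εR⌉₊ ⌈β ^ εR⌉₊ hRT hS hQ2 hQsq
  rw [h4] at hcore
  -- transport of the mean from `ζ` to `W` (kernel bridge, loop locality)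
  have hmean := integral_boxKernelG_eq_of_gauge_trunc ρ hρc β ⌈β ^ θ⌉₊ ζ g (measurable_loopCost ρ hρc β (rectWalk x 1 2 ⌈β ^ εR⌉₊ ⌈β ^ εR⌉₊))
    (isZdGaugeInvariant_loopCost ρ β (rectWalk x 1 2 ⌈β ^ εR⌉₊ ⌈β ^ εR⌉₊)) (loopCost_eq_of_agree_enlarged ρ hx2 β)
  -- the constant term in the interface's units (U1, surface form)
  have hU1 := half_sum_sq_sum_dirBackground_sdatE_eq (H := ⌈β ^ θ⌉₊) hβ0.le ϑ (rectSurface x ⌈β ^ εR⌉₊ ⌈β ^ εR⌉₊)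
    (fun p : ZdPlaquette 4 => ((p.1, p.2.1.1, p.2.1.2) : Plaq 4))
  rw [← integral_const_mul, hmean, integral_const_mul]
  have hshape : β * (∫ U, ((N : ℝ) - (ρ (walkHolonomy U (rectWalk x 1 2 ⌈β ^ εR⌉₊ ⌈β ^ εR⌉₊))).trace.re) ∂(boxKernelG ρ β ⌈β ^ θ⌉₊
        (forestFix ⌈β ^ θ⌉₊ (glueWith (boxEdgesAt dirCorner (2 * ⌈β ^ θ⌉₊ + 3))
          (fun e' : ↥(boxEdgesAt dirCorner (2 * ⌈β ^ θ⌉₊ + 3)) => gaugeTransformZd g ζ e'.1) (fun _ => 1))))) -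
        (dimE ρ : ℝ) / 2 * (∑ p ∈ rectSurface x ⌈β ^ εR⌉₊ ⌈β ^ εR⌉₊, ∑ q ∈ rectSurface x ⌈β ^ εR⌉₊ ⌈β ^ εR⌉₊,
          boxDirProjKernel ⌈β ^ θ⌉₊ ((p.1, p.2.1.1, p.2.1.2) : Plaq 4) ((q.1, q.2.1.1, q.2.1.2) : Plaq 4)) -
        β * ∑ c, (∑ p ∈ rectSurface x ⌈β ^ εR⌉₊ ⌈β ^ εR⌉₊,
          sCirc (glue (pin := fun e => e ∉ dirFreeEdges ⌈β ^ θ⌉₊) dirCorner (2 * ⌈β ^ θ⌉₊ + 3) ((Real.sqrt 2)⁻¹ • ϑ c)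
            (mean (fun e => e ∉ dirFreeEdges ⌈β ^ θ⌉₊) dirCorner (2 * ⌈β ^ θ⌉₊ + 3) ((Real.sqrt 2)⁻¹ • ϑ c))) ((p.1, p.2.1.1, p.2.1.2) : Plaq 4)) ^ 2 =
      β * (∫ U, ((N : ℝ) - (ρ (walkHolonomy U (rectWalk x 1 2 ⌈β ^ εR⌉₊ ⌈β ^ εR⌉₊))).trace.re) ∂(boxKernelG ρ β ⌈β ^ θ⌉₊
        (forestFix ⌈β ^ θ⌉₊ (glueWith (boxEdgesAt dirCorner (2 * ⌈β ^ θ⌉₊ + 3))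
          (fun e' : ↥(boxEdgesAt dirCorner (2 * ⌈β ^ θ⌉₊ + 3)) => gaugeTransformZd g ζ e'.1) (fun _ => 1))))) -
        ((dimE ρ : ℝ) / 2 * (∑ p ∈ rectSurface x ⌈β ^ εR⌉₊ ⌈β ^ εR⌉₊, ∑ q ∈ rectSurface x ⌈β ^ εR⌉₊ ⌈β ^ εR⌉₊,
            boxDirProjKernel ⌈β ^ θ⌉₊ ((p.1, p.2.1.1, p.2.1.2) : Plaq 4) ((q.1, q.2.1.1, q.2.1.2) : Plaq 4)) +
          1 / 2 * ∑ c, (∑ p ∈ rectSurface x ⌈β ^ εR⌉₊ ⌈β ^ εR⌉₊,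
            sCirc (glue (pin := fun e => e ∉ dirFreeEdges ⌈β ^ θ⌉₊) dirCorner (2 * ⌈β ^ θ⌉₊ + 3) (sdatE β ϑ c)
              (mean (fun e => e ∉ dirFreeEdges ⌈β ^ θ⌉₊) dirCorner (2 * ⌈β ^ θ⌉₊ + 3) (sdatE β ϑ c))) ((p.1, p.2.1.1, p.2.1.2) : Plaq 4)) ^ 2) := by
    rw [hU1]; ring
  rw [hshape]
  refine hcore.trans (le_trans ?_ hfinal)
  -- monotonicity: the tilt size (actual cards ≤ `120(2H+1)⁴`, `4(2H+1)⁴`) and the fourth-moment constant (`|F_c| ≤ R²R'`, `0 ≤ V ≤ R⁴`)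
  have hw := tiltSize_le_cardBound ⌈β ^ θ⌉₊ hτ0 hℓ0
  have hexp := Real.exp_le_exp.2 (mul_le_mul_of_nonneg_left hw (by norm_num : (0 : ℝ) ≤ 2))
  have hM0 : 0 ≤ β * (8 * (dimE ρ : ℝ) * ((⌈β ^ εR⌉₊ : ℝ) * ⌈β ^ εR⌉₊ * (2 * ((12 * (⌈β ^ θ⌉₊ : ℝ) ^ 2 + 2 * ⌈β ^ θ⌉₊ + 1) * (Real.sqrt 2 * Real.sqrt (β ^ (2 * (6 * θ) - 1)) + 8 * (Ca * β ^ (3 * θ + δ - 1 / 2)))))) ^ 2 + 9 * (2 * ((⌈β ^ εR⌉₊ : ℝ) + ⌈β ^ εR⌉₊) * (2 * ((12 * (⌈β ^ θ⌉₊ : ℝ) ^ 2 + 2 * ⌈β ^ θ⌉₊ + 1) * (Real.sqrt 2 * Real.sqrt (β ^ (2 * (6 * θ) - 1)) + 8 * (Ca * β ^ (3 * θ + δ - 1 / 2)))))) ^ 3) := by positivity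
  have key := mul_le_mul_of_nonneg_left (sub_le_sub_right hexp 1) hM0
  have hFb : ∀ c, |∑ p ∈ rectSurface x ⌈β ^ εR⌉₊ ⌈β ^ εR⌉₊, sCirc (glue (pin := fun e => e ∉ dirFreeEdges ⌈β ^ θ⌉₊) dirCorner (2 * ⌈β ^ θ⌉₊ + 3) (sdatE β ϑ c)
      (mean (fun e => e ∉ dirFreeEdges ⌈β ^ θ⌉₊) dirCorner (2 * ⌈β ^ θ⌉₊ + 3) (sdatE β ϑ c))) ((p.1, p.2.1.1, p.2.1.2) : Plaq 4)| ≤ (⌈β ^ εR⌉₊ : ℝ) ^ 2 * (Real.sqrt (β * (CE * (2 * (⌈β ^ θ⌉₊ : ℝ) + 3) ^ 4 * β ^ (2 * δ - 1))) + 4 * (Real.sqrt β * (Ca * β ^ (3 * θ + δ - 1 / 2)))) :=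
    fun c => abs_sum_rectSurface_le (F := fun p : ZdPlaquette 4 => sCirc (glue (pin := fun e => e ∉ dirFreeEdges ⌈β ^ θ⌉₊) dirCorner (2 * ⌈β ^ θ⌉₊ + 3)
      (sdatE β ϑ c) (mean (fun e => e ∉ dirFreeEdges ⌈β ^ θ⌉₊) dirCorner (2 * ⌈β ^ θ⌉₊ + 3) (sdatE β ϑ c))) ((p.1, p.2.1.1, p.2.1.2) : Plaq 4)) (hF c)
  obtain ⟨hV0, hV⟩ := surfInductance_nonneg_le ⌈β ^ θ⌉₊ ⌈β ^ εR⌉₊ x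
  have hB := sum_pow_four_add_sq_le (D := dimE ρ) hFb hV0 hV
  have hsqP : 0 ≤ Real.sqrt (240 * (dimE ρ : ℝ) * (2 * (⌈β ^ θ⌉₊ : ℝ) + 1) ^ 4 *
      Real.exp (-(β ^ (6 * θ) / (4 * (Real.sqrt (dimE ρ) + 1))) ^ 2 / 2)) := Real.sqrt_nonneg _
  have hD0 : (0 : ℝ) ≤ (dimE ρ : ℝ) := Nat.cast_nonneg _
  have hB2 := mul_le_mul_of_nonneg_left hB (by positivity : (0 : ℝ) ≤ 2 * (dimE ρ : ℝ))
  have hAB : 2 * (1 + 2 * (dimE ρ : ℝ) * ∑ c, ((∑ p ∈ rectSurface x ⌈β ^ εR⌉₊ ⌈β ^ εR⌉₊,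
        sCirc (glue (pin := fun e => e ∉ dirFreeEdges ⌈β ^ θ⌉₊) dirCorner (2 * ⌈β ^ θ⌉₊ + 3) (sdatE β ϑ c)
          (mean (fun e => e ∉ dirFreeEdges ⌈β ^ θ⌉₊) dirCorner (2 * ⌈β ^ θ⌉₊ + 3) (sdatE β ϑ c))) ((p.1, p.2.1.1, p.2.1.2) : Plaq 4)) ^ 4 +
        3 * (∑ p ∈ rectSurface x ⌈β ^ εR⌉₊ ⌈β ^ εR⌉₊, ∑ q ∈ rectSurface x ⌈β ^ εR⌉₊ ⌈β ^ εR⌉₊,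
          boxDirProjKernel ⌈β ^ θ⌉₊ ((p.1, p.2.1.1, p.2.1.2) : Plaq 4) ((q.1, q.2.1.1, q.2.1.2) : Plaq 4)) ^ 2)) ≤
      2 * (1 + 2 * (dimE ρ : ℝ) * ((dimE ρ : ℝ) * (((⌈β ^ εR⌉₊ : ℝ) ^ 2 * (Real.sqrt (β * (CE * (2 * (⌈β ^ θ⌉₊ : ℝ) + 3) ^ 4 * β ^ (2 * δ - 1))) + 4 * (Real.sqrt β * (Ca * β ^ (3 * θ + δ - 1 / 2))))) ^ 4 + 3 * (⌈β ^ εR⌉₊ : ℝ) ^ 8))) := by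
    linarith [hB2]
  have hmono := mul_le_mul_of_nonneg_right hAB hsqP
  linarith [key, hmono]

end Summit.QuantumFields.YangMills.Theorems.SoftLoopLongLag

end
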